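import Summits.QuantumFields.YangMills.Theorems.BalabanUVNodesK0V23Stub3FinVolSuppliers
import Summits.QuantumFields.YangMills.Theorems.BalabanUVNodesK0V23Stub3Sockets
import Literature.MathematicalPhysics.QuantumFieldTheory.Balaban1983to89.B12Decay510
import Summits.QuantumFields.YangMills.Theses.BalabanUVNodes

/-!
# CRIT-1 (g31) CUT-1 kernel — VACUITY of lens-1 v0.5's hypothesis `N3PairLocalityAt` AS TYPED

refuter-ym-nodeO-crit-1-g31-0, 2026-08-30.  Object: lens-1 g0's HOME `nodeO-cover/LENS-1-NodeSketch.lean` v0.5 (sha16 7f952503ad989946),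
whose ★★★ `record13SepCoPHInhabited_of_N3pair` :637 derives K0⁷'s decl from ONE hypothesis shape `N3PairLocalityAt` :290.

FINDING (located-B ∕ vacuity, kernel-checked below): `N3PairLocalityAt` quantifies `∀ z : Fin 4 → ℤ` WITHOUT the fundamental-window guard
`(∀ i, 2|z i| < N_{k+1})` that v0's `N3_UniformLocalAnalyticRep` and `N2_FundWindowDecay` carry, while the represented object `kerZB … z` is a TORUS kernel —
`polWindow` reads `z` through `siteOfInt` = the cast `ℤ → ZMod N_{k+1}` (`Node00/BetaOfRecord.lean` :85, :117), hence PERIODIC in `z`.  The tree's (5.10) engine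
`B12Decay510.abs_twoPoint_le_of_analytic` turns the hypothesis at `z` into `|kerZB z| ≤ C₅₁₀ e^{−δ₁‖z‖₁}` with UNIFORM `C₅₁₀, δ₁ > 0`; applied at the translates
`z + n N_{k+1} e₀` (same torus site) and `n → ∞` it forces `kerZB ≡ 0`.  So the hypothesis of the ★★★ theorem says: «at some print-regime member per radius, the
windowed vacuum-polarisation kernel of the merged term of record VANISHES IDENTICALLY (every level, box history, volume, μν, z)» — the tree's own negative-control
pattern (K-uniform decay on all of ℤ⁴ ⇒ Π ≡ 0).  REPAIR (free): restore the window guard on `z` (as in v0's N3 :99–:112); see the sheet for the second, independent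
remark (junk inhabitation from N2 ∧ L-I1 when the representation is ∃-chosen per z).

Nothing of Bałaban asserted; `kerZB` and `N3PairLocalityAt` below are lens-1's definitions VERBATIM (attributed); the two theorems are mine.  K0⁷ NOT closed; Clay NOT touched.
-/

noncomputable section

open Filter Topology Metric
open scoped BigOperators Matrix.Norms.L2Operator

namespace Summit.QuantumFields.YangMills.Cruxes.Record13SepCoPHInhabited.Crit1Cut1Lens1Vacuity

open Literature.MathematicalPhysics.QuantumFieldTheory.Balaban1983to89
open Literature.MathematicalPhysics.QuantumFieldTheory.Balaban1983to89.Node00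
open Literature.MathematicalPhysics.QuantumFieldTheory.Balaban1983to89.T4Continuum
open Literature.MathematicalPhysics.QuantumFieldTheory.Balaban1983to89.FlowStep
open Literature.MathematicalPhysics.QuantumFieldTheory.Balaban1983to89.B12Sec2to5 (Decay510 l1 betaPrime510)
open Literature.MathematicalPhysics.QuantumFieldTheory.Balaban1983to89.B12Decay510
open Literature.MathematicalPhysics.QuantumFieldTheory.Balaban1983to89.B15DeterminingSets

/-! ## §1  lens-1's objects, VERBATIM (v0.5 7f952503ad989946 :60 and :290; author of record planner-ymgap-nodeO-lens-1-g0-0) -/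

/-- `Π_K(k, v; z)` at the window member `θ₁₃ᶜᶜᴹᵂᶻᴮ(j; γ₀; a₀; ε₀, ε₂₉; B₃, B₃′, a₀, a₁; Efl, logz)`: the (0,1)-component of the windowed finite-torus polarisation kernel
(1.20) of the MERGED new term (1.6) of record at level `k + 1`, history `v`, volume `K`, displacement `z`. [cite: Balaban1987RG1, (1.20)–(1.21) p.264, (1.6) p.261] -/
def kerZB (F : T4Family) (j : ℕ) (γ₀ a₀ ε₀ ε₂₉ B₃ B₃' a₁ : ℝ) (Efl logz : B12.RunParams → ℕ → ℝ)
    (k : ℕ) (v : Fin (k + 1) → ℝ) (K : ℕ) (μ ν : Fin 4) (z : Fin 4 → ℤ) : ℝ :=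
  letI θ := theta13OfThm1CCMWZB F 2 j γ₀ a₀ ε₀ ε₂₉ B₃ B₃' a₀ a₁ Efl logz
  letI := θ.instVβ₁; letI := θ.instVβ₂; letI := θ.instιβ
  polWindow F K (k + 1) (mergedTermFamilyMatT F 2 (TβOfRecord₁₃ F 2) (chiβOfRecord₁₃ F 2 θ) θ.εbg k v K) θ.ρ8 θ.bV μ ν z


open Classical in
/-- **N3-PAIR LOCALITY at the window member** (Skolemized in the volume index): for every (k, v, μ, ν, z) a K-indexed family of finite systems as in N3 (common
response space `ℂ^m`), representing `Π_K(k,v;μν;z)`, together with, for each K, a finset of «wrapping» domains of `T_K` (tree length ≥ N_K∕M), an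
injection of the non-wrapping domains into the domains of `T_{K+1}` that preserves the PIECE `E_X` EXACTLY (locality) and moves the two response vectors by at
most `B_h e^{−δ₀N_K∕2}e^{−(δ₀∕2)dist}` (minimizer tails), every unmatched domain of `T_{K+1}` having tree length ≥ N_K∕M; leaves at the engine's rates AND at the
halved rates (κ∕4, δ₀∕4). [cite: Balaban1987RG1, (1.7) p.261, (1.18) p.263, (1.21) p.264, (4.35) p.287; Balaban1985Variational, Prop. 9] -/
def N3PairLocalityAt (F : T4Family) (j : ℕ) (γ₀ a₀ ε₀ ε₂₉ B₃ B₃' a₁ : ℝ) (Efl logz : B12.RunParams → ℕ → ℝ)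
    (α₂ E₀ Bh κ δ₀ M c₁ K₀ K₁ K₀' K₁' : ℝ) : Prop :=
  ∀ k (v : Fin (k + 1) → ℝ), v ∈ Box γ₀ k → ∀ (μ ν : Fin 4) (z : Fin 4 → ℤ),
    ∃ (S : ℕ → LocDomainSys) (Cc : (K : ℕ) → B12.CubeCover (S K)) (Λ : ℕ → Type) (G : (K : ℕ) → SiteGeometry (Cc K) (Λ K))
      (ρ : (K : ℕ) → Λ K → Λ K → ℝ) (m : ℕ) (EX : (K : ℕ) → (S K).Dom → (Fin m → ℂ) → ℂ) (h : (K : ℕ) → (S K).Dom → Λ K → (Fin m → ℂ))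
      (x₀ xz : (K : ℕ) → Λ K) (wrap : (K : ℕ) → Finset (S K).Dom) (emb : (K : ℕ) → (S K).Dom → (S (K + 1)).Dom),
      ∀ K : ℕ,
        (∀ X, AnalyticOnNhd ℂ (EX K X) (ball 0 α₂)) ∧
        (∀ X, ∀ w ∈ ball (0 : Fin m → ℂ) α₂, ‖EX K X w‖ ≤ E₀ * Real.exp (-κ * (S K).dj X)) ∧
        (∀ X x, ‖h K X x‖ ≤ Bh * Real.exp (-δ₀ * (G K).distD x X)) ∧
        GeomLeaf (G K) (ρ K) M c₁ ∧ CubeSumLeaf (G K) (δ₀ / 2) K₁ ∧ TreeLeaf (Cc K) (κ / 2) K₀ ∧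
        CubeSumLeaf (G K) (δ₀ / 2 / 2) K₁' ∧ TreeLeaf (Cc K) (κ / 2 / 2) K₀' ∧
        ρ K (x₀ K) (xz K) = l1 z ∧
        kerZB F j γ₀ a₀ ε₀ ε₂₉ B₃ B₃' a₁ Efl logz k v K μ ν z = ∑ X, (mixedDeriv (EX K X) (h K X (x₀ K)) (h K X (xz K))).re ∧
        Set.InjOn (emb K) ((wrap K)ᶜ : Finset (S K).Dom) ∧
        (∀ X ∈ wrap K, ((F.P K).sitesPerDir (k + 1) : ℝ) / M ≤ (S K).dj X) ∧
        (∀ Y : (S (K + 1)).Dom, (∀ X, X ∉ wrap K → emb K X ≠ Y) → ((F.P K).sitesPerDir (k + 1) : ℝ) / M ≤ (S (K + 1)).dj Y) ∧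
        (∀ X, X ∉ wrap K → EX (K + 1) (emb K X) = EX K X) ∧
        (∀ X, X ∉ wrap K → ‖h (K + 1) (emb K X) (x₀ (K + 1)) - h K X (x₀ K)‖
            ≤ Bh * Real.exp (-δ₀ * ((F.P K).sitesPerDir (k + 1) : ℝ) / 2) * Real.exp (-(δ₀ / 2) * (G K).distD (x₀ K) X)) ∧
        (∀ X, X ∉ wrap K → ‖h (K + 1) (emb K X) (xz (K + 1)) - h K X (xz K)‖
            ≤ Bh * Real.exp (-δ₀ * ((F.P K).sitesPerDir (k + 1) : ℝ) / 2) * Real.exp (-(δ₀ / 2) * (G K).distD (xz K) X))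


/-! ## §2  Periodicity of the torus kernel in `z` (the cast `ℤ → ZMod N`) -/

/-- `siteOfInt` is periodic with period `N_j = (F.P K).sitesPerDir j` in every coordinate direction. [folklore] -/
theorem siteOfInt_add_period (F : T4Family) (K j : ℕ) (z : Fin 4 → ℤ) (i₀ : Fin 4) (n : ℤ) :
    siteOfInt F K j (z + Pi.single i₀ (n * ((F.P K).sitesPerDir j : ℤ))) = siteOfInt F K j z := by
  funext i
  simp only [siteOfInt, Pi.add_apply, Pi.single_apply, Int.cast_add]
  split_ifs
  · simp [Int.cast_mul, Int.cast_natCast]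
  · simp

/-- Hence lens-1's `kerZB` is periodic in `z` with period `N_{k+1}` in direction `i₀`. [folklore] -/
theorem kerZB_add_period (F : T4Family) (j : ℕ) (γ₀ a₀ ε₀ ε₂₉ B₃ B₃' a₁ : ℝ) (Efl logz : B12.RunParams → ℕ → ℝ)
    (k : ℕ) (v : Fin (k + 1) → ℝ) (K : ℕ) (μ ν : Fin 4) (z : Fin 4 → ℤ) (i₀ : Fin 4) (n : ℤ) :
    kerZB F j γ₀ a₀ ε₀ ε₂₉ B₃ B₃' a₁ Efl logz k v K μ ν (z + Pi.single i₀ (n * ((F.P K).sitesPerDir (k + 1) : ℤ))) =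
      kerZB F j γ₀ a₀ ε₀ ε₂₉ B₃ B₃' a₁ Efl logz k v K μ ν z := by
  unfold kerZB polWindow
  rw [siteOfInt_add_period]

/-! ## §3  The (5.10) engine on the hypothesis: a UNIFORM exponential bound at EVERY `z ∈ ℤ⁴` -/

/-- `N3PairLocalityAt` at `z` ⟹ `|kerZB z| ≤ C₅₁₀ e^{−δ₁‖z‖₁}` with `C₅₁₀ = 4E₀α₂⁻²B_h²e^{δ₁Mc₁}K₀K₁`, `δ₁ = delta1 δ₀ κ M`, for EVERY `z` (no window). -/
theorem abs_kerZB_le_of_N3pair (F : T4Family) (j : ℕ) (γ₀ a₀ ε₀ ε₂₉ B₃ B₃' a₁ : ℝ) (Efl logz : B12.RunParams → ℕ → ℝ)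
    {α₂ E₀ Bh κ δ₀ M c₁ K₀ K₁ K₀' K₁' : ℝ} (hα₂ : 0 < α₂) (hE₀ : 0 ≤ E₀) (hBh : 0 ≤ Bh) (hK₀ : 0 ≤ K₀) (hδ₀ : 0 ≤ δ₀) (hκ : 0 ≤ κ) (hM : 0 < M)
    (hP : N3PairLocalityAt F j γ₀ a₀ ε₀ ε₂₉ B₃ B₃' a₁ Efl logz α₂ E₀ Bh κ δ₀ M c₁ K₀ K₁ K₀' K₁')
    (k : ℕ) (v : Fin (k + 1) → ℝ) (hv : v ∈ Box γ₀ k) (K : ℕ) (μ ν : Fin 4) (z : Fin 4 → ℤ) :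
    |kerZB F j γ₀ a₀ ε₀ ε₂₉ B₃ B₃' a₁ Efl logz k v K μ ν z| ≤
      4 * E₀ / α₂ ^ 2 * Bh ^ 2 * Real.exp (delta1 δ₀ κ M * M * c₁) * K₀ * K₁ * Real.exp (-(delta1 δ₀ κ M) * l1 z) := by
  obtain ⟨S, Cc, Λ, G, ρ, m, EX, h, x₀, xz, wrap, emb, hall⟩ := hP k v hv μ ν z
  obtain ⟨han, h118, hh, hgeo, hcube, htree, -, -, hρ, hrepr, -⟩ := hall K
  rw [hrepr, ← hρ]
  exact abs_twoPoint_le_of_analytic (G K) (EX K) (h K) (fun X x y => (mixedDeriv (EX K X) (h K X x) (h K X y)).re)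
    hα₂ hE₀ hBh hK₀ hδ₀ hκ hM han h118 (fun _ _ _ => rfl) hh hgeo hcube htree (x₀ K) (xz K)

/-! ## §4  ★ VACUITY: the hypothesis forces `kerZB ≡ 0` -/

/-- `‖z + c e₀‖₁ ≥ |c| − ‖z‖₁`. [folklore] -/
theorem l1_add_single_ge (z : Fin 4 → ℤ) (c : ℤ) : (|(c : ℝ)| - l1 z) ≤ l1 (z + Pi.single (0 : Fin 4) c) := by
  set w : Fin 4 → ℤ := z + Pi.single (0 : Fin 4) c with hw
  have h0 : |(w 0 : ℝ)| ≤ l1 w := by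
    unfold l1
    exact Finset.single_le_sum (f := fun μ => |(w μ : ℝ)|) (fun _ _ => abs_nonneg _) (Finset.mem_univ 0)
  have hz0 : |(z 0 : ℝ)| ≤ l1 z := by
    unfold l1
    exact Finset.single_le_sum (f := fun μ => |(z μ : ℝ)|) (fun _ _ => abs_nonneg _) (Finset.mem_univ 0)
  have h1 : (w 0 : ℝ) = (z 0 : ℝ) + (c : ℝ) := by simp [hw]
  have h2 : |(c : ℝ)| ≤ |((z 0 : ℝ) + (c : ℝ))| + |(z 0 : ℝ)| := by
    calc |(c : ℝ)| = |((z 0 : ℝ) + c) + -(z 0 : ℝ)| := by ring_nf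
      _ ≤ |((z 0 : ℝ) + c)| + |-(z 0 : ℝ)| := abs_add_le _ _
      _ = _ := by rw [abs_neg]
  rw [h1] at h0
  linarith

/-- **★ THE HYPOTHESIS OF lens-1's `record13SepCoPHInhabited_of_N3pair` FORCES `Π ≡ 0`**: under `N3PairLocalityAt` (with the sign conditions the ★★★ theorem carries),
the windowed polarisation kernel of the merged term of record at the member vanishes at EVERY level `k`, box history `v`, volume `K`, `μν` and `z`.
Mechanism: §3 at the translates `z + nN_{k+1}e₀` (§2: same value) and `n → ∞`. [folklore] -/
theorem kerZB_eq_zero_of_N3pair (F : T4Family) (j : ℕ) (γ₀ a₀ ε₀ ε₂₉ B₃ B₃' a₁ : ℝ) (Efl logz : B12.RunParams → ℕ → ℝ)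
    {α₂ E₀ Bh κ δ₀ M c₁ K₀ K₁ K₀' K₁' : ℝ} (hα₂ : 0 < α₂) (hE₀ : 0 ≤ E₀) (hBh : 0 ≤ Bh) (hK₀ : 0 ≤ K₀) (hK₁ : 0 ≤ K₁) (hδ₀ : 0 < δ₀) (hκ : 0 < κ) (hM : 0 < M)
    (hP : N3PairLocalityAt F j γ₀ a₀ ε₀ ε₂₉ B₃ B₃' a₁ Efl logz α₂ E₀ Bh κ δ₀ M c₁ K₀ K₁ K₀' K₁')
    (k : ℕ) (v : Fin (k + 1) → ℝ) (hv : v ∈ Box γ₀ k) (K : ℕ) (μ ν : Fin 4) (z : Fin 4 → ℤ) :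
    kerZB F j γ₀ a₀ ε₀ ε₂₉ B₃ B₃' a₁ Efl logz k v K μ ν z = 0 := by
  set N : ℕ := (F.P K).sitesPerDir (k + 1) with hN
  set δ₁ : ℝ := delta1 δ₀ κ M with hδ₁
  set C : ℝ := 4 * E₀ / α₂ ^ 2 * Bh ^ 2 * Real.exp (δ₁ * M * c₁) * K₀ * K₁ with hC
  have hδ₁pos : 0 < δ₁ := delta1_pos hδ₀ hκ hM
  have hNpos : (1 : ℝ) ≤ (N : ℝ) := by
    have : N ≠ 0 := (F.P K).sitesPerDir_ne_zero (k + 1)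
    exact_mod_cast Nat.one_le_iff_ne_zero.mpr this
  -- the bound at the n-th translate, rewritten as a geometric sequence
  have hbound : ∀ n : ℕ, |kerZB F j γ₀ a₀ ε₀ ε₂₉ B₃ B₃' a₁ Efl logz k v K μ ν z| ≤
      C * Real.exp (δ₁ * l1 z) * Real.exp (-(δ₁ * N)) ^ n := by
    intro n
    have hper := kerZB_add_period F j γ₀ a₀ ε₀ ε₂₉ B₃ B₃' a₁ Efl logz k v K μ ν z 0 (n : ℤ)
    have hle := abs_kerZB_le_of_N3pair F j γ₀ a₀ ε₀ ε₂₉ B₃ B₃' a₁ Efl logz hα₂ hE₀ hBh hK₀ hδ₀.le hκ.le hM hP k v hv K μ ν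
      (z + Pi.single (0 : Fin 4) ((n : ℤ) * (N : ℤ)))
    rw [hper] at hle
    have hl1 := l1_add_single_ge z ((n : ℤ) * (N : ℤ))
    have habs : |(((n : ℤ) * (N : ℤ) : ℤ) : ℝ)| = (n : ℝ) * N := by
      push_cast; exact abs_of_nonneg (by positivity)
    rw [habs] at hl1
    have hCnn : 0 ≤ C := by rw [hC]; positivity
    calc |kerZB F j γ₀ a₀ ε₀ ε₂₉ B₃ B₃' a₁ Efl logz k v K μ ν z|
        ≤ C * Real.exp (-δ₁ * l1 (z + Pi.single (0 : Fin 4) ((n : ℤ) * (N : ℤ)))) := by simpa [hC, hδ₁] using hle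
      _ ≤ C * Real.exp (-δ₁ * ((n : ℝ) * N - l1 z)) := by
          refine mul_le_mul_of_nonneg_left (Real.exp_le_exp.mpr ?_) hCnn
          have := mul_le_mul_of_nonneg_left hl1 hδ₁pos.le
          linarith
      _ = C * Real.exp (δ₁ * l1 z) * Real.exp (-(δ₁ * N)) ^ n := by
          rw [← Real.exp_nat_mul, mul_assoc C, ← Real.exp_add]; ring_nf
  -- the geometric sequence tends to 0
  have hr : Real.exp (-(δ₁ * N)) < 1 := by
    rw [← Real.exp_zero]; exact Real.exp_lt_exp.mpr (by nlinarith)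
  have hT : Tendsto (fun n : ℕ => C * Real.exp (δ₁ * l1 z) * Real.exp (-(δ₁ * N)) ^ n) atTop (𝓝 0) := by
    simpa using (tendsto_const_nhds (x := C * Real.exp (δ₁ * l1 z))).mul
      (tendsto_pow_atTop_nhds_zero_of_lt_one (Real.exp_pos _).le hr)
  have h0 : |kerZB F j γ₀ a₀ ε₀ ε₂₉ B₃ B₃' a₁ Efl logz k v K μ ν z| ≤ 0 :=
    ge_of_tendsto' hT hbound
  exact abs_eq_zero.mp (le_antisymm h0 (abs_nonneg _))

/-- **COROLLARY (the shape the ★★★ theorem consumes)**: its hypothesis `H` says that for every family and radius SOME print-regime member has an identically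
vanishing windowed polarisation kernel on its box. -/
theorem pol_vanishes_of_lens1_H
    (H : ∀ (F : T4Family) (a₀ : ℝ), 0 < a₀ → ∃ (γ₀ ε₂₉ : ℝ) (j : ℕ) (ε₀ B₃ B₃' a₁ : ℝ) (Efl logz : B12.RunParams → ℕ → ℝ)
      (α₂ E₀ Bh κ δ₀ M c₁ K₀ K₁ K₀' K₁' : ℝ), 0 < γ₀ ∧ γ₀ ≤ 1 / 2 ∧ 0 < ε₂₉ ∧ 0 < α₂ ∧ 0 ≤ E₀ ∧ 0 ≤ Bh ∧ 0 ≤ K₀ ∧ 0 ≤ K₁ ∧ 0 ≤ K₀' ∧ 0 ≤ K₁' ∧ 0 < δ₀ ∧ 0 < κ ∧ 0 < M ∧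
      N3PairLocalityAt F j γ₀ a₀ ε₀ ε₂₉ B₃ B₃' a₁ Efl logz α₂ E₀ Bh κ δ₀ M c₁ K₀ K₁ K₀' K₁')
    (F : T4Family) (a₀ : ℝ) (ha₀ : 0 < a₀) :
    ∃ (γ₀ ε₂₉ : ℝ) (j : ℕ) (ε₀ B₃ B₃' a₁ : ℝ) (Efl logz : B12.RunParams → ℕ → ℝ), 0 < γ₀ ∧
      ∀ k (v : Fin (k + 1) → ℝ), v ∈ Box γ₀ k → ∀ K (μ ν : Fin 4) (z : Fin 4 → ℤ), kerZB F j γ₀ a₀ ε₀ ε₂₉ B₃ B₃' a₁ Efl logz k v K μ ν z = 0 := by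
  obtain ⟨γ₀, ε₂₉, j, ε₀, B₃, B₃', a₁, Efl, logz, α₂, E₀, Bh, κ, δ₀, M, c₁, K₀, K₁, K₀', K₁', hγ₀, -, -, hα₂, hE₀, hBh, hK₀, hK₁, -, -, hδ₀, hκ, hM, hP⟩ :=
    H F a₀ ha₀
  exact ⟨γ₀, ε₂₉, j, ε₀, B₃, B₃', a₁, Efl, logz, hγ₀, fun k v hv K μ ν z =>
    kerZB_eq_zero_of_N3pair F j γ₀ a₀ ε₀ ε₂₉ B₃ B₃' a₁ Efl logz hα₂ hE₀ hBh hK₀ hK₁ hδ₀ hκ hM hP k v hv K μ ν z⟩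

end Summit.QuantumFields.YangMills.Cruxes.Record13SepCoPHInhabited.Crit1Cut1Lens1Vacuity

end
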